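import Summits.NavierStokesRegularity.NavierStokesRegularity.Theorems.BoundedTemperatureClosed.Negative.ZeroDatumFloor
import Summits.NavierStokesRegularity.NavierStokesRegularity.Theorems.PumpContinuationBoundedTemperatureClosedSegmentAveraged

/-!
# Crux `BoundedTemperatureClosed` (stmt-NavierStokesRegularity-18303), negative side:
# the collinear sector and the restatement bite table (line lead c2)

Planner-facing, kernel-checked facts about HOW the Link may be restated (leads c0/c1 and three refuters
agree the crux as filed, `∀ 𝒜 ∀ M, IsClosed S_{𝒜,M}`, is over-quantified: at the zero averaging datum it is
EQUIVALENT to the registered open statement `¬ TypeIInfimumNotAttainedNS`,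
`isClosed_btSet_iff_not_typeIInfimumNotAttainedNS`). The obstruction lives on the COLLINEAR SECTOR — data
whose averaged form is a real multiple `κ·B` of the Euler form on `H¹⁰_df` — and this file maps it:

* `exists_form_eq_smul_eulerForm` — for EVERY real `κ` there is a symmetric cancelling averaging datum with
  `B̃ = κ·B` on `H¹⁰_df` (Tao 2016 §3.1–§3.2 via the landed `complexAverage_isAveraged_holds`); along its
  segment `T_θ = c(θ)·B`, `c(θ) = (1-θ)κ + θ`, and for `c(θ) > 0` membership in the crux's set at ceiling `M`
  is the Navier–Stokes Type-I statement `nsTypeI[c(θ)·M]` (`mem_btSet_iff_of_form_eq_smul`, amplitude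
  scaling `u ↦ c(θ)u`).
* **Bite 1 (new): the endpoint-only Link WITH the Type-I ceiling kept is still hostage to `H`.**
  `endpointLinkTypeI` = "accumulation of members at `θ → 1⁻` puts `1` in the set" is implied by the crux
  (`endpointLinkTypeI_of_boundedTemperatureClosed`) and would suffice for `closes`
  (`nsTypeI_of_endpointLinkTypeI_of_door`), but `TypeIInfimumNotAttainedNS → ¬ endpointLinkTypeI`
  (`not_endpointLinkTypeI_of_typeIInfimumNotAttainedNS`): witness the datum `B̃ = 2B`, ceiling `K` — every
  `θ < 1` is a member (`c(θ)K = (2-θ)K > K`), `θ = 1` is not.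
* **Bite 2** (dropping the Type-I ceiling reverses the sign: Type-I-free `∀ 𝒜` closedness implies that
  Navier–Stokes has NO Schwartz-data mild blow-up, and with the Door that it HAS one) is the companion file
  `TypeIFreeBites.lean`.
* **The consistent repair (refuter-rreview's `BoundedTemperatureClosedAtOne`): endpoint-only, Type-I-free
  CONCLUSION.** `linkAtOne ↔ (EulerProximatePump → nsMild)` (`linkAtOne_iff_door_imp`) — it is exactly
  "the Door implies a Schwartz-data mild Navier–Stokes blow-up" — and it HOLDS on the whole collinear
  sector unconditionally (`linkAtOne_of_form_eq_smul`), so no `κ·B` datum bites it.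

Statement shapes are local notations (no new definitions). Tools: the landed zero-datum files, the
amplitude scaling `typeIBlowup_smul`, and `PumpContinuationBoundedTemperatureClosedSegmentAveraged`
(`isMildSolutionFor_Ico_congr_memH10df`, `eulerForm_im_eq_zero`).

## References

* T. Tao, J. Amer. Math. Soc. 29 (2016), arXiv:1402.0290v3, §1.1 (1.13), (1.15), §3.1–§3.2. [`Tao2016AveragedNS`]
* W. Rusin, V. Šverák, J. Funct. Anal. 260 (2011), arXiv:0911.0500, §1 question (Q). [`RusinSverak2011`]
-/

noncomputable section

-- the nested summit namespace `…NavierStokesRegularity.NavierStokesRegularity…` is the tree's layout (D-0017)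
set_option linter.dupNamespace false

namespace Summit.NavierStokesRegularity.NavierStokesRegularity.Theorems.BoundedTemperatureClosed.Negative

open MeasureTheory Set Filter Topology
open scoped ENNReal
open Literature.Analysis.FluidPDE Literature.Analysis.FluidPDE.Tao2016

/-- The bounded-temperature blow-up set of the datum `𝒜` at ceiling `M` along the segment
`T_θ = (1-θ)·B̃_𝒜 + θ·B` — verbatim the set whose closedness the crux asserts. -/
local notation3 "btSet[" 𝒜 ", " M "]" =>
  {θ : ℝ | θ ∈ Set.Icc (0 : ℝ) 1 ∧
    ∃ u₀ : SchwartzMap (EuclideanSpace ℝ (Fin 3)) (EuclideanSpace ℝ (Fin 3)),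
      Literature.Analysis.FluidPDE.VectorCalculus.IsDivFree ⇑u₀ ∧ ∃ S : ℝ, 0 < S ∧
      ∃ u : ℝ → Literature.Analysis.FluidPDE.Tao2016.L2C,
        Literature.Analysis.FluidPDE.Tao2016.IsMildSolutionFor
          (fun a b c => ((1 - θ : ℝ) : ℂ) * AveragingDatum.form 𝒜 a b c +
            ((θ : ℝ) : ℂ) * Literature.Analysis.FluidPDE.Tao2016.eulerForm a b c)
          (Literature.Analysis.FluidPDE.Tao2016.schwartzL2 u₀) (Set.Ico 0 S) u ∧
        (∀ t ∈ Set.Ico 0 S, MeasureTheory.eLpNorm (u t) ⊤ MeasureTheory.volume ≤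
          ENNReal.ofReal (M / Real.sqrt (S - t))) ∧
        ¬ ∃ S' : ℝ, S < S' ∧ ∃ v : ℝ → Literature.Analysis.FluidPDE.Tao2016.L2C,
          Literature.Analysis.FluidPDE.Tao2016.IsMildSolutionFor
            (fun a b c => ((1 - θ : ℝ) : ℂ) * AveragingDatum.form 𝒜 a b c +
              ((θ : ℝ) : ℂ) * Literature.Analysis.FluidPDE.Tao2016.eulerForm a b c)
            (Literature.Analysis.FluidPDE.Tao2016.schwartzL2 u₀) (Set.Ico 0 S') v ∧
          ∀ t ∈ Set.Ico 0 S, v t = u t}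

/-- **Navier–Stokes has a Schwartz-data `H¹⁰_df`-mild Type-I blow-up at ceiling `M`** (membership of the
crux's set at the Euler end `θ = 1`). -/
local notation3 "nsTypeI[" M "]" =>
  ∃ u₀ : SchwartzMap (EuclideanSpace ℝ (Fin 3)) (EuclideanSpace ℝ (Fin 3)),
    Literature.Analysis.FluidPDE.VectorCalculus.IsDivFree ⇑u₀ ∧ ∃ S : ℝ, 0 < S ∧
    ∃ u : ℝ → Literature.Analysis.FluidPDE.Tao2016.L2C,
      Literature.Analysis.FluidPDE.Tao2016.IsMildSolutionFor
        Literature.Analysis.FluidPDE.Tao2016.eulerForm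
        (Literature.Analysis.FluidPDE.Tao2016.schwartzL2 u₀) (Set.Ico 0 S) u ∧
      (∀ t ∈ Set.Ico 0 S, MeasureTheory.eLpNorm (u t) ⊤ MeasureTheory.volume ≤
        ENNReal.ofReal (M / Real.sqrt (S - t))) ∧
      ¬ ∃ S' : ℝ, S < S' ∧ ∃ v : ℝ → Literature.Analysis.FluidPDE.Tao2016.L2C,
        Literature.Analysis.FluidPDE.Tao2016.IsMildSolutionFor
          Literature.Analysis.FluidPDE.Tao2016.eulerForm
          (Literature.Analysis.FluidPDE.Tao2016.schwartzL2 u₀) (Set.Ico 0 S') v ∧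
        ∀ t ∈ Set.Ico 0 S, v t = u t

/-- **Navier–Stokes has a Schwartz-data `H¹⁰_df`-mild solution with no mild extension** (no rate) — the
hypothesis shape of the route's proved bridge `MildBlowupClassical`. -/
local notation3 "nsMild" =>
  ∃ u₀ : SchwartzMap (EuclideanSpace ℝ (Fin 3)) (EuclideanSpace ℝ (Fin 3)),
    Literature.Analysis.FluidPDE.VectorCalculus.IsDivFree ⇑u₀ ∧ ∃ S : ℝ, 0 < S ∧
    ∃ u : ℝ → Literature.Analysis.FluidPDE.Tao2016.L2C,
      Literature.Analysis.FluidPDE.Tao2016.IsMildSolutionFor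
        Literature.Analysis.FluidPDE.Tao2016.eulerForm
        (Literature.Analysis.FluidPDE.Tao2016.schwartzL2 u₀) (Set.Ico 0 S) u ∧
      ¬ ∃ S' : ℝ, S < S' ∧ ∃ v : ℝ → Literature.Analysis.FluidPDE.Tao2016.L2C,
        Literature.Analysis.FluidPDE.Tao2016.IsMildSolutionFor
          Literature.Analysis.FluidPDE.Tao2016.eulerForm
          (Literature.Analysis.FluidPDE.Tao2016.schwartzL2 u₀) (Set.Ico 0 S') v ∧
        ∀ t ∈ Set.Ico 0 S, v t = u t

/-- **Door-type accumulation at `(𝒜, M)`**: members of `S_{𝒜,M}` strictly below and arbitrarily close to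
the Euler end `θ = 1` (the body of `EulerProximatePump` at a fixed datum and ceiling). -/
local notation3 "doorAt[" 𝒜 ", " M "]" =>
  ∀ δ : ℝ, 0 < δ → ∃ θ : ℝ, 1 - δ < θ ∧ θ < 1 ∧ θ ∈ btSet[𝒜, M]

/-! ### The collinear sector: data with `B̃ = κ·B` on `H¹⁰_df`, every real `κ` -/

/-- **Collinear data exist for every real `κ`**: a symmetric cancelling averaging datum whose form is
`κ·⟨B(u,v), w⟩` on `H¹⁰_df` (Tao 2016, §3.2 ¶1: `κ·B` is a complex average of `B`; §3.1: a complex average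
real on real fields is an averaged Euler form — the landed `complexAverage_isAveraged_holds`). `κ = 0, ±1`
recover the zero / Euler / minus-Euler data of the earlier negative files. [cite: Tao2016AveragedNS, §3.1–§3.2 p. 15] -/
theorem exists_form_eq_smul_eulerForm (κ : ℝ) :
    ∃ 𝒜 : AveragingDatum, 𝒜.IsSymmetric ∧ 𝒜.HasCancellation ∧
      ∀ u v w : L2C, MemH10df u → MemH10df v → MemH10df w →
        𝒜.form u v w = ((κ : ℝ) : ℂ) * eulerForm u v w := by
  obtain ⟨𝒜, h⟩ := complexAverage_isAveraged_holds (fun u v w => ((κ : ℝ) : ℂ) * eulerForm u v w)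
    (isComplexAverageOf_eulerForm_self.smul_eulerForm ((κ : ℝ) : ℂ))
    (fun u v w hu hv hw => by
      simp only [Complex.im_ofReal_mul, PumpContinuationSegmentAveraged.eulerForm_im_eq_zero hu hv hw,
        mul_zero])
  refine ⟨𝒜, fun u v w hu hv hw => ?_, fun u hu => ?_, h⟩
  · rw [h u v w hu hv hw, h v u w hv hu hw, eulerForm_symm]
  · rw [h u u u hu hu hu, ← AveragingDatum.euler_form, AveragingDatum.euler_hasCancellation u hu, mul_zero]

/-- **Membership along a collinear segment is a Navier–Stokes Type-I statement.** If `B̃_𝒜 = κ·B` on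
`H¹⁰_df`, then for `θ ∈ [0,1]` with `c := (1-θ)κ + θ > 0`: `θ ∈ S_{𝒜,M} ↔ nsTypeI[c·M]` — on `H¹⁰_df` the
segment form is `c·B` (`isMildSolutionFor_Ico_congr_memH10df`), and `u ↦ c u`, `u ↦ c⁻¹ u` exchange
`c·B`-witnesses at ceiling `M` with `B`-witnesses at ceiling `cM` (`typeIBlowup_smul`). [cite: Tao2016AveragedNS, §1.1 (1.15)] -/
theorem mem_btSet_iff_of_form_eq_smul {𝒜 : AveragingDatum} {κ : ℝ}
    (hκ : ∀ u v w : L2C, MemH10df u → MemH10df v → MemH10df w →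
      𝒜.form u v w = ((κ : ℝ) : ℂ) * eulerForm u v w)
    {θ : ℝ} (hθ0 : 0 ≤ θ) (hθ1 : θ ≤ 1) (hc : 0 < (1 - θ) * κ + θ) (M : ℝ) :
    θ ∈ btSet[𝒜, M] ↔ nsTypeI[((1 - θ) * κ + θ) * M] := by
  set c : ℝ := (1 - θ) * κ + θ with hcdef
  have hdiag : ∀ a w : L2C, MemH10df a → MemH10df w →
      ((1 - θ : ℝ) : ℂ) * 𝒜.form a a w + ((θ : ℝ) : ℂ) * eulerForm a a w =
        ((c : ℝ) : ℂ) * eulerForm a a w := fun a w ha hw => by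
    rw [hκ a a w ha ha hw, hcdef]
    push_cast
    ring
  have hT1 : ∀ a b w : L2C, eulerForm (((c : ℝ) : ℂ) • a) (((c : ℝ) : ℂ) • b) w =
      ((c : ℝ) : ℂ) * (((c : ℝ) : ℂ) * eulerForm a b w) := fun a b w => by
    rw [eulerForm_smul_smul]
    ring
  have hT2 : ∀ a b w : L2C, ((c : ℝ) : ℂ) * eulerForm (((c⁻¹ : ℝ) : ℂ) • a) (((c⁻¹ : ℝ) : ℂ) • b) w =
      ((c⁻¹ : ℝ) : ℂ) * eulerForm a b w := fun a b w => by
    have hcC : ((c : ℝ) : ℂ) ≠ 0 := Complex.ofReal_ne_zero.2 hc.ne'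
    rw [eulerForm_smul_smul, Complex.ofReal_inv]
    field_simp
  simp only [mem_setOf_eq,
    PumpContinuationSegmentAveraged.isMildSolutionFor_Ico_congr_memH10df
      (T := fun a b w => ((1 - θ : ℝ) : ℂ) * 𝒜.form a b w + ((θ : ℝ) : ℂ) * eulerForm a b w)
      (T' := fun a b w => ((c : ℝ) : ℂ) * eulerForm a b w) hdiag]
  constructor
  · rintro ⟨-, hw⟩
    exact PumpContinuationEulerProximatePump.typeIBlowup_smul (fun a b w => ((c : ℝ) : ℂ) * eulerForm a b w)
      eulerForm c hc hT1 M hw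
  · intro hw
    have h := PumpContinuationEulerProximatePump.typeIBlowup_smul eulerForm
      (fun a b w => ((c : ℝ) : ℂ) * eulerForm a b w) c⁻¹ (inv_pos.2 hc) hT2 (c * M) hw
    rw [← mul_assoc, inv_mul_cancel₀ hc.ne', one_mul] at h
    exact ⟨⟨hθ0, hθ1⟩, h⟩

/-- At the Euler end the segment form IS the Euler form, so `1 ∈ S_{𝒜,M} ↔ nsTypeI[M]` for EVERY datum. [folklore] -/
theorem one_mem_btSet_iff (𝒜 : AveragingDatum) (M : ℝ) : (1 : ℝ) ∈ btSet[𝒜, M] ↔ nsTypeI[M] := by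
  have hform : (fun a b w => (((1 : ℝ) - 1 : ℝ) : ℂ) * 𝒜.form a b w + (((1 : ℝ) : ℝ) : ℂ) * eulerForm a b w) =
      eulerForm := by
    funext a b w
    push_cast
    ring
  simp only [mem_setOf_eq, hform]
  exact ⟨fun h => h.2, fun h => ⟨⟨zero_le_one, le_rfl⟩, h⟩⟩

/-! ### Bite 1: the endpoint-only Link with the Type-I ceiling KEPT is hostage to `H` -/

/-- **The endpoint Link with Type-I kept** — accumulation of members at `1⁻` puts `1` in the set — follows
from the crux as filed (closedness; the argument of `closes`). [folklore] -/
theorem endpointLinkTypeI_of_boundedTemperatureClosed (hC : Theses.PumpContinuation.BoundedTemperatureClosed)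
    (𝒜 : AveragingDatum) (hs : 𝒜.IsSymmetric) (hc : 𝒜.HasCancellation) (M : ℝ) (hacc : doorAt[𝒜, M]) :
    (1 : ℝ) ∈ btSet[𝒜, M] := by
  have hcl := hC 𝒜 hs hc M
  rw [← hcl.closure_eq, Metric.mem_closure_iff]
  intro ε hε
  obtain ⟨θ, h1, h2, hmem⟩ := hacc ε hε
  refine ⟨θ, hmem, ?_⟩
  rw [Real.dist_eq, abs_of_nonneg (by linarith)]
  linarith

/-- **… and it would suffice for `closes`**: with the Door it yields a Schwartz-data mild Type-I blow-up of
Navier–Stokes (at the Door's datum and ceiling; `one_mem_btSet_iff`). [folklore] -/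
theorem nsTypeI_of_endpointLinkTypeI_of_door
    (hL : ∀ 𝒜 : AveragingDatum, 𝒜.IsSymmetric → 𝒜.HasCancellation → ∀ M : ℝ, doorAt[𝒜, M] →
      (1 : ℝ) ∈ btSet[𝒜, M])
    (hD : Theses.PumpContinuation.EulerProximatePump) : ∃ M : ℝ, nsTypeI[M] := by
  obtain ⟨𝒜, hs, hc, M, hM⟩ := hD
  refine ⟨M, (one_mem_btSet_iff 𝒜 M).1 (hL 𝒜 hs hc M fun δ hδ => ?_)⟩
  obtain ⟨θ, h1, h2, h0, hrest⟩ := hM δ hδ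
  exact ⟨θ, h1, h2, ⟨h0, h2.le⟩, hrest⟩

/-- **Bite 1.** `TypeIInfimumNotAttainedNS → ¬ (endpoint Link with Type-I kept)`: at the collinear datum
`B̃ = 2B` and the ceiling `K` of `H`, every `θ ∈ [1/2, 1)` is a member (`c(θ)K = (2-θ)K > K` is an admissible
Navier–Stokes ceiling), so members accumulate at `1`, but `1` is a member iff `nsTypeI[K]`, which `H` denies.
So "localise to the endpoint but keep the rate" is NOT a repair. [cite: RusinSverak2011, §1 question (Q)] -/
theorem not_endpointLinkTypeI_of_typeIInfimumNotAttainedNS (hH : TypeIInfimumNotAttainedNS) :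
    ¬ ∀ 𝒜 : AveragingDatum, 𝒜.IsSymmetric → 𝒜.HasCancellation → ∀ M : ℝ, doorAt[𝒜, M] →
      (1 : ℝ) ∈ btSet[𝒜, M] := by
  intro hL
  obtain ⟨K, hK, hnot, hall⟩ := hH
  obtain ⟨𝒜, hs, hc, hκ⟩ := exists_form_eq_smul_eulerForm 2
  have hacc : doorAt[𝒜, K] := by
    intro δ hδ
    refine ⟨max (1 - δ / 2) (1 / 2), lt_max_of_lt_left (by linarith), max_lt (by linarith) (by norm_num), ?_⟩
    set θ : ℝ := max (1 - δ / 2) (1 / 2) with hθ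
    have hθ0 : 1 / 2 ≤ θ := le_max_right _ _
    have hθ1 : θ < 1 := max_lt (by linarith) (by norm_num)
    have hcpos : 0 < (1 - θ) * 2 + θ := by linarith
    refine (mem_btSet_iff_of_form_eq_smul hκ (by linarith) hθ1.le hcpos K).2 (hall _ ?_)
    nlinarith
  exact hnot ((one_mem_btSet_iff 𝒜 K).1 (hL 𝒜 hs hc K hacc))

/-! ### The consistent repair: endpoint-only, Type-I-free conclusion (`AtOne`) -/

/-- **The Door, refolded through `doorAt`** (pure repackaging of `0 ≤ θ ∧ …` as `θ ∈ [0,1] ∧ …`). [folklore] -/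
theorem eulerProximatePump_iff_exists_doorAt :
    Theses.PumpContinuation.EulerProximatePump ↔
      ∃ 𝒜 : AveragingDatum, 𝒜.IsSymmetric ∧ 𝒜.HasCancellation ∧ ∃ M : ℝ, doorAt[𝒜, M] := by
  constructor
  · rintro ⟨𝒜, hs, hc, M, hM⟩
    refine ⟨𝒜, hs, hc, M, fun δ hδ => ?_⟩
    obtain ⟨θ, h1, h2, h0, hrest⟩ := hM δ hδ
    exact ⟨θ, h1, h2, ⟨h0, h2.le⟩, hrest⟩
  · rintro ⟨𝒜, hs, hc, M, hM⟩
    refine ⟨𝒜, hs, hc, M, fun δ hδ => ?_⟩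
    obtain ⟨θ, h1, h2, ⟨h0, -⟩, hrest⟩ := hM δ hδ
    exact ⟨θ, h1, h2, h0, hrest⟩

/-- **`AtOne` is exactly "the Door implies a Schwartz-data mild Navier–Stokes blow-up".** The refuter's
repair `BoundedTemperatureClosedAtOne` (`∀ 𝒜` sym canc `∀ M`, Door-type accumulation at `(𝒜,M)` ⇒ `nsMild`)
has a conclusion free of `𝒜, M, θ`, so it is equivalent to `EulerProximatePump → nsMild`; with the proved
bridge `MildBlowupClassical` and `blowup_assembly` this is the whole route minus the Door (an honest
conditional LINK, difficulty that of the persistence of the singularity as `θ → 1`, not `L`). [folklore] -/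
theorem linkAtOne_iff_door_imp :
    (∀ 𝒜 : AveragingDatum, 𝒜.IsSymmetric → 𝒜.HasCancellation → ∀ M : ℝ, doorAt[𝒜, M] → nsMild) ↔
      (Theses.PumpContinuation.EulerProximatePump → nsMild) := by
  rw [eulerProximatePump_iff_exists_doorAt]
  constructor
  · rintro h ⟨𝒜, hs, hc, M, hM⟩
    exact h 𝒜 hs hc M hM
  · intro h 𝒜 hs hc M hM
    exact h ⟨𝒜, hs, hc, M, hM⟩

/-- **`AtOne` holds on the whole collinear sector, unconditionally** (so no `κ·B` datum bites it, in
contrast with the crux as filed, `endpointLinkTypeI` and `typeIFreeClosed`): if `B̃_𝒜 = κ·B` on `H¹⁰_df`,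
Door-type accumulation at `(𝒜, M)` supplies a member `θ < 1` so close to `1` that `c(θ) = (1-θ)κ + θ > 0`,
i.e. `nsTypeI[c(θ)M]`, in particular a Schwartz-data mild Navier–Stokes blow-up. [cite: Tao2016AveragedNS, §1.1 (1.15)] -/
theorem linkAtOne_of_form_eq_smul {𝒜 : AveragingDatum} {κ : ℝ}
    (hκ : ∀ u v w : L2C, MemH10df u → MemH10df v → MemH10df w →
      𝒜.form u v w = ((κ : ℝ) : ℂ) * eulerForm u v w)
    (M : ℝ) (hacc : doorAt[𝒜, M]) : nsMild := by
  obtain ⟨θ, h1, h2, hmem⟩ := hacc (1 / (|1 - κ| + 1)) (by positivity)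
  have hθ0 : 0 ≤ θ := hmem.1.1
  have hcpos : 0 < (1 - θ) * κ + θ := by
    have hlt : (1 - θ) * |1 - κ| < 1 := by
      have hpos : 0 < |1 - κ| + 1 := by positivity
      have h3 : 1 - θ < 1 / (|1 - κ| + 1) := by linarith
      calc (1 - θ) * |1 - κ| ≤ 1 / (|1 - κ| + 1) * |1 - κ| :=
            mul_le_mul_of_nonneg_right h3.le (abs_nonneg _)
        _ < 1 := by
            rw [div_mul_eq_mul_div, one_mul, div_lt_one hpos]
            linarith
    have h4 : (1 - θ) * (1 - κ) ≤ (1 - θ) * |1 - κ| :=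
      mul_le_mul_of_nonneg_left (le_abs_self _) (by linarith)
    nlinarith
  obtain ⟨u₀, hdiv, S, hS, u, hu, -, hno⟩ := (mem_btSet_iff_of_form_eq_smul hκ hθ0 h2.le hcpos M).1 hmem
  exact ⟨u₀, hdiv, S, hS, u, hu, hno⟩

end Summit.NavierStokesRegularity.NavierStokesRegularity.Theorems.BoundedTemperatureClosed.Negative

end
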